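import Mathlib.Analysis.SpecialFunctions.Pow.Real

/-!
# T⁴ programme, spine node NE2 (U1a), lane P2 — «V-AVG-G AT TAXI DATA», file 7: THE DECAY OF THE (ONE-min) TRANSFER OUTPUTS — REAL ALGEBRA CORE
# (the `let` telescope of leaf-04-g7's `VariationalColourTaxiTowerCentred.hONEm_taxi` over ABSTRACT atoms, all five free parameters set to `τ = θ^k`;
# Mathlib only; model level; cell `pub-balaban`)

NE2 formalisation swarm `b2b-balaban-t4-ne2-formalise-*`, leaf prover 10 GEN 5 (`prover-b2b-balaban-t4-ne2-formalise-leaf-10-g5-0`, V-END holder lineage); item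
«V-AVG-G AT TAXI DATA», file 7 (journal NOTE l.22515: the decay lemma both END hosts at taxi data need).  Nothing imported from the tree; nothing defined.

THE SHAPE.  `hONEm_taxi` (p238755) outputs, per level `k`, the (ONE-min) costs `ε₁ = (A−1) + A·ε + B` and `δ′₁ = √A·δ′`, where `eH, e₂, ε, δ′, v, γ, Λf, A, B` are an
explicit telescope in: the level size `N = L^k`, the level plaquette bound `a`, ONE⁺'s size `X = (d−1)(L−1)(2L−1)b_k`, FED⁺'s size `Y = (d−1)L(L−1)b_k`, the two-step frame
distance `F = L(L^k−1)(L−1)b_k`, the composite frames' reverse-Poincaré constant `R`, the fine plaquette number `NB = (L^{k+1})²b_k`, the supplier's fine V-UB constant `Λᵥ`,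
the package's `Λf`, the colour pair's `Λ, C_P, C_R`, the V-REG constant `C_Rv`, the (GF3) constants `C_D, C_D′, C_D₁, C_D₁′`, and the free `s, t, u, u₂, w`.  THIS FILE bounds
that telescope — written VERBATIM over abstract real atoms, with `s = t = u = u₂ = w := τ` — by `C·τ` from the ATOM BOUNDS the taxi class delivers (file 6
`VariationalColourTaxiClassReadings`): `(N²)⁻¹ ≤ τ⁴`, `N·X ≤ C_X τ²`, `X ≤ C_X τ⁴`, `N·Y ≤ C_Y τ²`, `Y ≤ C_Y τ⁴`, `N²a ≤ c`, `a²N² ≤ c²τ⁴`, `NB ≤ c`, `F ≤ cτ²`, `R ≤ R⋆`,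
`Λᵥ ≤ Λᵥ⋆`, `Λf ≤ Λf⋆`, `0 < τ ≤ 1`:
 * §1 `eH_le` (`eH ≤ E_H⋆·τ²`), §2 `e2_le` (`0 ≤ e₂ ≤ E₂⋆·τ`), §3 `eps_le` (`0 ≤ ε ≤ E⋆·τ`), §4 `v_le` ∕ `gamma_le` ∕ `deltaP_le` (`v ≤ V⋆τ`, `γ ≤ Γ⋆τ⁴`, `δ′ ≤ D⋆τ²`),
   §5 `AB_le` (`A ≤ A⋆`, `A − 1 ≤ A₁⋆τ`, `B ≤ B⋆τ`), §6 **`oneMin_outputs_le`**: `(A−1) + A·ε + B ≤ (A₁⋆ + A⋆E⋆ + B⋆)·τ` and `√A·δ′ ≤ √A⋆D⋆·τ`, `v ≤ V⋆`, `γ ≤ Γ⋆`,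
   the starred constants written out as `let`s (each sub-lemma keeps its own small context — the telescope is assembled by typed `have`s only).
THIS FILE = §0–§2 (`pow_facts`, `one_add_inv_mul_pow4_le`, `eH_le`, `one_add_inv_mul_sq_le`, `eH_nonneg`, `EHs_nonneg`, `e2_le`); §3–§6 are file 7b `VariationalColourTaxiOneMinDecay`.
The instance at Bałaban's taxi data (atoms := the tower's quantities, bounds := file 6 + the class package) is the next file.

HONEST FRAMING (T4-DAG p. 1).  Real algebra only; OUR constants; thresholds quantitatively void; nothing printed is a hypothesis; no `def`, no `def … : Prop`, no `sorry`;
axioms standard.  NOT an END statement; V-END with background ∕ NE2 NOT proved; NE3 OPEN; spine PROVED 0∕9 unchanged; rung (B)+1 on a fixed finite T⁴ — NOT infinite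
volume, NOT mass gap, NOT Clay.  HONEST DEPENDENCY (cell, verbatim): continuum YM on T⁴ ⇐ BetaPertH ∧ nine spine estimates (0/9 proved); BetaPertH ⇐ (D1) ∧ (D4) ∧
CAP+tail; G-an2-4 gates asym, D1 and NE2/3/4.
-/

noncomputable section

namespace Summit.QuantumFields.BalabanUV.T4Continuum.VariationalColourTaxiOneMinDecayCore

/-! ## §0 Three powers of `τ ∈ (0,1]` -/

/-- `τ⁴ ≤ τ²`, `τ³ ≤ τ`, `τ² ≤ τ`, `τ⁴ ≤ τ` on `[0,1]`. [folklore] -/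
theorem pow_facts {τ : ℝ} (h0 : 0 ≤ τ) (h1 : τ ≤ 1) : τ ^ 4 ≤ τ ^ 2 ∧ τ ^ 3 ≤ τ ∧ τ ^ 2 ≤ τ ∧ τ ^ 4 ≤ τ := by
  have h2 : τ ^ 2 ≤ τ := by rw [sq]; exact mul_le_of_le_one_left h0 h1
  have h21 : τ ^ 2 ≤ 1 := h2.trans h1
  have h42 : τ ^ 4 ≤ τ ^ 2 := by
    calc τ ^ 4 = τ ^ 2 * τ ^ 2 := by ring
      _ ≤ τ ^ 2 * 1 := mul_le_mul_of_nonneg_left h21 (sq_nonneg τ)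
      _ = τ ^ 2 := mul_one _
  have h3 : τ ^ 3 ≤ τ := by
    calc τ ^ 3 = τ ^ 2 * τ := by ring
      _ ≤ 1 * τ := mul_le_mul_of_nonneg_right h21 h0
      _ = τ := one_mul _
  exact ⟨h42, h3, h2, h42.trans h2⟩

/-- `(1 + τ⁻¹)·τ⁴ ≤ 2τ` and `(1 + τ⁻¹)·τ² ≤ 2τ`... precisely: `(1 + τ⁻¹)·(K·τ⁴) ≤ 2K·τ` for `0 ≤ K`, `0 < τ ≤ 1`. [folklore] -/
theorem one_add_inv_mul_pow4_le {τ K : ℝ} (h0 : 0 < τ) (h1 : τ ≤ 1) (hK : 0 ≤ K) : (1 + τ⁻¹) * (K * τ ^ 4) ≤ 2 * K * τ := by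
  obtain ⟨h42, h3, h2, h4⟩ := pow_facts h0.le h1
  have h' : τ⁻¹ * τ ^ 4 = τ ^ 3 := by
    rw [show τ ^ 4 = τ * τ ^ 3 by ring, ← mul_assoc, inv_mul_cancel₀ h0.ne', one_mul]
  have e : (1 + τ⁻¹) * (K * τ ^ 4) = K * (τ ^ 4 + τ ^ 3) := by
    calc (1 + τ⁻¹) * (K * τ ^ 4) = K * (τ ^ 4 + τ⁻¹ * τ ^ 4) := by ring
      _ = K * (τ ^ 4 + τ ^ 3) := by rw [h']
  rw [e]
  have : τ ^ 4 + τ ^ 3 ≤ 2 * τ := by linarith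
  calc K * (τ ^ 4 + τ ^ 3) ≤ K * (2 * τ) := mul_le_mul_of_nonneg_left this hK
    _ = 2 * K * τ := by ring

/-! ## §1 The harmonic-approximation defect `eH` -/

/-- **`eH ≤ E_H⋆·τ²`**: `ε₁⁰ ≤ E₁τ⁴` (`≤ E₁τ²`, `≤ E₁`), `δ⁰′ = C′·(N·L·X) ≤ C′·L·C_X·τ²`, `δ⁰ = √d·(N·Y) ≤ √d·C_Y·τ²`. [folklore] -/
theorem eH_le {d L : ℕ} {N X Y Λ CP CR CX CY τ : ℝ} (hτ0 : 0 < τ) (hτ1 : τ ≤ 1) (hN0 : 0 < N) (hNi : (N ^ 2)⁻¹ ≤ τ ^ 4)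
    (hX0 : 0 ≤ X) (hCX0 : 0 ≤ CX) (hXN : N * X ≤ CX * τ ^ 2) (hY0 : 0 ≤ Y) (hYN : N * Y ≤ CY * τ ^ 2)
    (hΛ : 0 ≤ Λ) (hCP : 0 ≤ CP) (hCR : 0 ≤ CR) :
    (((d : ℝ) / 4 + 1 / 2) * ((L : ℝ) / N ^ 2)) * CR * (Λ + 1)
        + 2 * (Real.sqrt (2 * d * (1 + (d : ℝ) ^ 2)) * (N * L * X)) * Real.sqrt ((Λ + (((d : ℝ) / 4 + 1 / 2) * ((L : ℝ) / N ^ 2)) * CR * (Λ + 1)) * (CP * (Λ + 1)))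
        + (Real.sqrt (2 * d * (1 + (d : ℝ) ^ 2)) * (N * L * X)) ^ 2 * (CP * (Λ + 1))
        + 2 * (Real.sqrt d * (N * Y)) * Real.sqrt (Λ * (CP * (Λ + 1)))
      ≤ ((((d : ℝ) / 4 + 1 / 2) * L) * CR * (Λ + 1)
          + 2 * (Real.sqrt (2 * d * (1 + (d : ℝ) ^ 2)) * (L * CX)) * Real.sqrt ((Λ + (((d : ℝ) / 4 + 1 / 2) * L) * CR * (Λ + 1)) * (CP * (Λ + 1)))
          + (Real.sqrt (2 * d * (1 + (d : ℝ) ^ 2)) * (L * CX)) ^ 2 * (CP * (Λ + 1))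
          + 2 * (Real.sqrt d * CY) * Real.sqrt (Λ * (CP * (Λ + 1)))) * τ ^ 2 := by
  obtain ⟨h42, h3, h2, h4⟩ := pow_facts hτ0.le hτ1
  have hd0 : (0 : ℝ) ≤ d := Nat.cast_nonneg d
  have hL0 : (0 : ℝ) ≤ L := Nat.cast_nonneg L
  have hτ20 : 0 ≤ τ ^ 2 := sq_nonneg τ
  have hτ21 : τ ^ 2 ≤ 1 := h2.trans hτ1
  -- `ε₁⁰ ≤ E₁τ⁴ ≤ E₁τ² ≤ E₁`
  have hE : ((d : ℝ) / 4 + 1 / 2) * ((L : ℝ) / N ^ 2) ≤ (((d : ℝ) / 4 + 1 / 2) * L) * τ ^ 2 := by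
    have : (L : ℝ) / N ^ 2 ≤ L * τ ^ 2 := by
      rw [div_eq_mul_inv]; exact mul_le_mul_of_nonneg_left (hNi.trans h42) hL0
    calc ((d : ℝ) / 4 + 1 / 2) * ((L : ℝ) / N ^ 2) ≤ ((d : ℝ) / 4 + 1 / 2) * (L * τ ^ 2) := mul_le_mul_of_nonneg_left this (by positivity)
      _ = (((d : ℝ) / 4 + 1 / 2) * L) * τ ^ 2 := by ring
  have hE0 : 0 ≤ ((d : ℝ) / 4 + 1 / 2) * ((L : ℝ) / N ^ 2) := by positivity
  have hE1 : ((d : ℝ) / 4 + 1 / 2) * ((L : ℝ) / N ^ 2) ≤ ((d : ℝ) / 4 + 1 / 2) * L := hE.trans (mul_le_of_le_one_right (by positivity) hτ21)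
  -- `δ⁰′ ≤ DP⋆τ²`, `δ⁰ ≤ DL⋆τ²`
  have hDP : Real.sqrt (2 * d * (1 + (d : ℝ) ^ 2)) * (N * L * X) ≤ (Real.sqrt (2 * d * (1 + (d : ℝ) ^ 2)) * (L * CX)) * τ ^ 2 := by
    have : N * L * X ≤ L * CX * τ ^ 2 := by nlinarith [mul_le_mul_of_nonneg_left hXN hL0]
    calc Real.sqrt (2 * d * (1 + (d : ℝ) ^ 2)) * (N * L * X) ≤ Real.sqrt (2 * d * (1 + (d : ℝ) ^ 2)) * (L * CX * τ ^ 2) :=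
          mul_le_mul_of_nonneg_left this (Real.sqrt_nonneg _)
      _ = (Real.sqrt (2 * d * (1 + (d : ℝ) ^ 2)) * (L * CX)) * τ ^ 2 := by ring
  have hDP0 : 0 ≤ Real.sqrt (2 * d * (1 + (d : ℝ) ^ 2)) * (N * L * X) := by positivity
  have hDPs0 : 0 ≤ Real.sqrt (2 * d * (1 + (d : ℝ) ^ 2)) * (L * CX) := by positivity
  have hDL : Real.sqrt d * (N * Y) ≤ (Real.sqrt d * CY) * τ ^ 2 := by
    calc Real.sqrt d * (N * Y) ≤ Real.sqrt d * (CY * τ ^ 2) := mul_le_mul_of_nonneg_left hYN (Real.sqrt_nonneg _)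
      _ = (Real.sqrt d * CY) * τ ^ 2 := by ring
  have hDL0 : 0 ≤ Real.sqrt d * (N * Y) := by positivity
  -- the four terms
  have hS1 : Real.sqrt ((Λ + (((d : ℝ) / 4 + 1 / 2) * ((L : ℝ) / N ^ 2)) * CR * (Λ + 1)) * (CP * (Λ + 1)))
      ≤ Real.sqrt ((Λ + (((d : ℝ) / 4 + 1 / 2) * L) * CR * (Λ + 1)) * (CP * (Λ + 1))) :=
    Real.sqrt_le_sqrt (mul_le_mul_of_nonneg_right (add_le_add_right (mul_le_mul_of_nonneg_right (mul_le_mul_of_nonneg_right hE1 hCR) (by linarith : (0 : ℝ) ≤ Λ + 1)) Λ) (by positivity))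
  have hS10 : 0 ≤ Real.sqrt ((Λ + (((d : ℝ) / 4 + 1 / 2) * ((L : ℝ) / N ^ 2)) * CR * (Λ + 1)) * (CP * (Λ + 1))) := Real.sqrt_nonneg _
  have t1 : (((d : ℝ) / 4 + 1 / 2) * ((L : ℝ) / N ^ 2)) * CR * (Λ + 1) ≤ ((((d : ℝ) / 4 + 1 / 2) * L) * CR * (Λ + 1)) * τ ^ 2 := by
    calc (((d : ℝ) / 4 + 1 / 2) * ((L : ℝ) / N ^ 2)) * CR * (Λ + 1) ≤ ((((d : ℝ) / 4 + 1 / 2) * L) * τ ^ 2) * CR * (Λ + 1) :=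
          mul_le_mul_of_nonneg_right (mul_le_mul_of_nonneg_right hE hCR) (by linarith : (0 : ℝ) ≤ Λ + 1)
      _ = ((((d : ℝ) / 4 + 1 / 2) * L) * CR * (Λ + 1)) * τ ^ 2 := by ring
  have t2 : 2 * (Real.sqrt (2 * d * (1 + (d : ℝ) ^ 2)) * (N * L * X)) * Real.sqrt ((Λ + (((d : ℝ) / 4 + 1 / 2) * ((L : ℝ) / N ^ 2)) * CR * (Λ + 1)) * (CP * (Λ + 1)))
      ≤ (2 * (Real.sqrt (2 * d * (1 + (d : ℝ) ^ 2)) * (L * CX)) * Real.sqrt ((Λ + (((d : ℝ) / 4 + 1 / 2) * L) * CR * (Λ + 1)) * (CP * (Λ + 1)))) * τ ^ 2 := by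
    calc 2 * (Real.sqrt (2 * d * (1 + (d : ℝ) ^ 2)) * (N * L * X)) * Real.sqrt ((Λ + (((d : ℝ) / 4 + 1 / 2) * ((L : ℝ) / N ^ 2)) * CR * (Λ + 1)) * (CP * (Λ + 1)))
        ≤ 2 * ((Real.sqrt (2 * d * (1 + (d : ℝ) ^ 2)) * (L * CX)) * τ ^ 2) * Real.sqrt ((Λ + (((d : ℝ) / 4 + 1 / 2) * L) * CR * (Λ + 1)) * (CP * (Λ + 1))) :=
          mul_le_mul (mul_le_mul_of_nonneg_left hDP (by norm_num)) hS1 hS10 (by positivity)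
      _ = _ := by ring
  have t3 : (Real.sqrt (2 * d * (1 + (d : ℝ) ^ 2)) * (N * L * X)) ^ 2 * (CP * (Λ + 1))
      ≤ ((Real.sqrt (2 * d * (1 + (d : ℝ) ^ 2)) * (L * CX)) ^ 2 * (CP * (Λ + 1))) * τ ^ 2 := by
    have hsq : (Real.sqrt (2 * d * (1 + (d : ℝ) ^ 2)) * (N * L * X)) ^ 2 ≤ ((Real.sqrt (2 * d * (1 + (d : ℝ) ^ 2)) * (L * CX)) * τ ^ 2) ^ 2 :=
      pow_le_pow_left₀ hDP0 hDP 2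
    have hτ4 : ((Real.sqrt (2 * d * (1 + (d : ℝ) ^ 2)) * (L * CX)) * τ ^ 2) ^ 2 ≤ (Real.sqrt (2 * d * (1 + (d : ℝ) ^ 2)) * (L * CX)) ^ 2 * τ ^ 2 := by
      rw [mul_pow]
      have : (τ ^ 2) ^ 2 ≤ τ ^ 2 := by nlinarith
      exact mul_le_mul_of_nonneg_left this (sq_nonneg _)
    calc (Real.sqrt (2 * d * (1 + (d : ℝ) ^ 2)) * (N * L * X)) ^ 2 * (CP * (Λ + 1)) ≤ ((Real.sqrt (2 * d * (1 + (d : ℝ) ^ 2)) * (L * CX)) ^ 2 * τ ^ 2) * (CP * (Λ + 1)) :=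
          mul_le_mul_of_nonneg_right (hsq.trans hτ4) (by positivity)
      _ = _ := by ring
  have t4 : 2 * (Real.sqrt d * (N * Y)) * Real.sqrt (Λ * (CP * (Λ + 1))) ≤ (2 * (Real.sqrt d * CY) * Real.sqrt (Λ * (CP * (Λ + 1)))) * τ ^ 2 := by
    calc 2 * (Real.sqrt d * (N * Y)) * Real.sqrt (Λ * (CP * (Λ + 1))) ≤ 2 * ((Real.sqrt d * CY) * τ ^ 2) * Real.sqrt (Λ * (CP * (Λ + 1))) :=
          mul_le_mul_of_nonneg_right (mul_le_mul_of_nonneg_left hDL (by norm_num)) (Real.sqrt_nonneg _)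
      _ = _ := by ring
  have e : ((((d : ℝ) / 4 + 1 / 2) * L) * CR * (Λ + 1)
          + 2 * (Real.sqrt (2 * d * (1 + (d : ℝ) ^ 2)) * (L * CX)) * Real.sqrt ((Λ + (((d : ℝ) / 4 + 1 / 2) * L) * CR * (Λ + 1)) * (CP * (Λ + 1)))
          + (Real.sqrt (2 * d * (1 + (d : ℝ) ^ 2)) * (L * CX)) ^ 2 * (CP * (Λ + 1))
          + 2 * (Real.sqrt d * CY) * Real.sqrt (Λ * (CP * (Λ + 1)))) * τ ^ 2
      = ((((d : ℝ) / 4 + 1 / 2) * L) * CR * (Λ + 1)) * τ ^ 2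
          + (2 * (Real.sqrt (2 * d * (1 + (d : ℝ) ^ 2)) * (L * CX)) * Real.sqrt ((Λ + (((d : ℝ) / 4 + 1 / 2) * L) * CR * (Λ + 1)) * (CP * (Λ + 1)))) * τ ^ 2
          + ((Real.sqrt (2 * d * (1 + (d : ℝ) ^ 2)) * (L * CX)) ^ 2 * (CP * (Λ + 1))) * τ ^ 2
          + (2 * (Real.sqrt d * CY) * Real.sqrt (Λ * (CP * (Λ + 1)))) * τ ^ 2 := by ring
  rw [e]
  exact add_le_add (add_le_add (add_le_add t1 t2) t3) t4

/-! ## §2 The transfer's FED⁺ budget `e₂` -/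

/-- `(1 + τ⁻¹)·(K·τ²) ≤ 2K·τ` for `0 ≤ K`, `0 < τ ≤ 1`. [folklore] -/
theorem one_add_inv_mul_sq_le {τ K : ℝ} (h0 : 0 < τ) (h1 : τ ≤ 1) (hK : 0 ≤ K) : (1 + τ⁻¹) * (K * τ ^ 2) ≤ 2 * K * τ := by
  obtain ⟨h42, h3, h2, h4⟩ := pow_facts h0.le h1
  have h' : τ⁻¹ * τ ^ 2 = τ := by
    rw [sq, ← mul_assoc, inv_mul_cancel₀ h0.ne', one_mul]
  have e : (1 + τ⁻¹) * (K * τ ^ 2) = K * (τ ^ 2 + τ) := by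
    calc (1 + τ⁻¹) * (K * τ ^ 2) = K * (τ ^ 2 + τ⁻¹ * τ ^ 2) := by ring
      _ = K * (τ ^ 2 + τ) := by rw [h']
  rw [e]
  have : τ ^ 2 + τ ≤ 2 * τ := by linarith
  calc K * (τ ^ 2 + τ) ≤ K * (2 * τ) := mul_le_mul_of_nonneg_left this hK
    _ = 2 * K * τ := by ring

/-- `0 ≤ eH`. [folklore] -/
theorem eH_nonneg {d L : ℕ} {N X Y Λ CP CR : ℝ} (hN0 : 0 < N) (hX0 : 0 ≤ X) (hY0 : 0 ≤ Y) (hΛ : 0 ≤ Λ) (hCP : 0 ≤ CP) (hCR : 0 ≤ CR) :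
    0 ≤ (((d : ℝ) / 4 + 1 / 2) * ((L : ℝ) / N ^ 2)) * CR * (Λ + 1)
        + 2 * (Real.sqrt (2 * d * (1 + (d : ℝ) ^ 2)) * (N * L * X))
          * Real.sqrt ((Λ + (((d : ℝ) / 4 + 1 / 2) * ((L : ℝ) / N ^ 2)) * CR * (Λ + 1)) * (CP * (Λ + 1)))
        + (Real.sqrt (2 * d * (1 + (d : ℝ) ^ 2)) * (N * L * X)) ^ 2 * (CP * (Λ + 1))
        + 2 * (Real.sqrt d * (N * Y)) * Real.sqrt (Λ * (CP * (Λ + 1))) := by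
  positivity

/-- `0 ≤ E_H⋆`. [folklore] -/
theorem EHs_nonneg {d L : ℕ} {Λ CP CR CX CY : ℝ} (hCX0 : 0 ≤ CX) (hCY0 : 0 ≤ CY) (hΛ : 0 ≤ Λ) (hCP : 0 ≤ CP) (hCR : 0 ≤ CR) :
    0 ≤ ((((d : ℝ) / 4 + 1 / 2) * L) * CR * (Λ + 1)
          + 2 * (Real.sqrt (2 * d * (1 + (d : ℝ) ^ 2)) * (L * CX)) * Real.sqrt ((Λ + (((d : ℝ) / 4 + 1 / 2) * L) * CR * (Λ + 1)) * (CP * (Λ + 1)))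
          + (Real.sqrt (2 * d * (1 + (d : ℝ) ^ 2)) * (L * CX)) ^ 2 * (CP * (Λ + 1))
          + 2 * (Real.sqrt d * CY) * Real.sqrt (Λ * (CP * (Λ + 1)))) := by
  positivity

/-- **`0 ≤ e₂ ≤ E₂⋆·τ`** — `e₂ = τ + 3(1+τ⁻¹)·(8d·S₄ + T₄ + T₅ + C_P·eH·(C_D+C_D′))` with `S₄, T₄, T₅ = O(τ⁴)` (from `(N²)⁻¹ ≤ τ⁴`, `X ≤ C_Xτ⁴`, `(N·X)² ≤ C_X²τ⁴`,
`a²N² ≤ c²τ⁴`, `N²a ≤ c`) and `eH ≤ E_H⋆τ²`; `(1+τ⁻¹)τ⁴ ≤ 2τ`, `(1+τ⁻¹)τ² ≤ 2τ`. [folklore] -/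
theorem e2_le {d L : ℕ} {N a X CRv CD CD' Λ CP c CX τ eH EHs : ℝ} (hτ0 : 0 < τ) (hτ1 : τ ≤ 1) (hN0 : 0 < N) (hNi : (N ^ 2)⁻¹ ≤ τ ^ 4)
    (ha0 : 0 ≤ a) (hna : N ^ 2 * a ≤ c) (haN : a ^ 2 * N ^ 2 ≤ c ^ 2 * τ ^ 4)
    (hX0 : 0 ≤ X) (hCX0 : 0 ≤ CX) (hXN : N * X ≤ CX * τ ^ 2) (hX : X ≤ CX * τ ^ 4)
    (hCRv : 0 ≤ CRv) (hCD : 0 ≤ CD) (hCD' : 0 ≤ CD') (hΛ : 0 ≤ Λ) (hCP : 0 ≤ CP) (hc0 : 0 ≤ c)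
    (heH0 : 0 ≤ eH) (heH : eH ≤ EHs * τ ^ 2) (hEHs0 : 0 ≤ EHs) :
    0 ≤ τ + 3 * (1 + τ⁻¹) * (8 * d * ((N ^ 2)⁻¹ * CRv
          + (1 + X) ^ 2 * ((d : ℝ) / 4 * L * ((N ^ 2)⁻¹ * CRv)) + X ^ 2 * ((2 * (1 + CD)) + (2 * (CD' + d * (N ^ 2 * a) * 64)))
          + X ^ 2 * (2 * (1 + (d : ℝ) ^ 2) * (L : ℝ) ^ 2 * (N ^ 2 * (max (40 * (2 * (1 + CD))) (64 + 40 * (2 * (CD' + d * (N ^ 2 * a) * 64)))))))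
        + (d : ℝ) / 2 * (2 * d * ((N ^ 2)⁻¹ * CRv) + 2 * (d : ℝ) ^ 2 * a ^ 2 * (N ^ 2 * (max (40 * (2 * (1 + CD))) (64 + 40 * (2 * (CD' + d * (N ^ 2 * a) * 64))))))
        + (d : ℝ) / 4 * (2 * (2 * d * ((N ^ 2)⁻¹ * CRv) + 2 * (d : ℝ) ^ 2 * a ^ 2 * (N ^ 2 * (max (40 * (2 * (1 + CD))) (64 + 40 * (2 * (CD' + d * (N ^ 2 * a) * 64)))))) + 2 * (Λ * (N ^ 2)⁻¹ * (CD + CD')))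
        + CP * eH * (CD + CD'))
    ∧ τ + 3 * (1 + τ⁻¹) * (8 * d * ((N ^ 2)⁻¹ * CRv
          + (1 + X) ^ 2 * ((d : ℝ) / 4 * L * ((N ^ 2)⁻¹ * CRv)) + X ^ 2 * ((2 * (1 + CD)) + (2 * (CD' + d * (N ^ 2 * a) * 64)))
          + X ^ 2 * (2 * (1 + (d : ℝ) ^ 2) * (L : ℝ) ^ 2 * (N ^ 2 * (max (40 * (2 * (1 + CD))) (64 + 40 * (2 * (CD' + d * (N ^ 2 * a) * 64)))))))
        + (d : ℝ) / 2 * (2 * d * ((N ^ 2)⁻¹ * CRv) + 2 * (d : ℝ) ^ 2 * a ^ 2 * (N ^ 2 * (max (40 * (2 * (1 + CD))) (64 + 40 * (2 * (CD' + d * (N ^ 2 * a) * 64))))))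
        + (d : ℝ) / 4 * (2 * (2 * d * ((N ^ 2)⁻¹ * CRv) + 2 * (d : ℝ) ^ 2 * a ^ 2 * (N ^ 2 * (max (40 * (2 * (1 + CD))) (64 + 40 * (2 * (CD' + d * (N ^ 2 * a) * 64)))))) + 2 * (Λ * (N ^ 2)⁻¹ * (CD + CD')))
        + CP * eH * (CD + CD'))
      ≤ (1 + 6 * ((8 * d * (CRv + (1 + CX) ^ 2 * ((d : ℝ) / 4 * L * CRv) + CX ^ 2 * ((2 * (1 + CD)) + (2 * (CD' + d * c * 64))) + 2 * (1 + (d : ℝ) ^ 2) * (L : ℝ) ^ 2 * (CX ^ 2 * (max (40 * (2 * (1 + CD))) (64 + 40 * (2 * (CD' + d * c * 64))))))) + ((d : ℝ) / 2 * (2 * d * CRv + 2 * (d : ℝ) ^ 2 * (c ^ 2 * (max (40 * (2 * (1 + CD))) (64 + 40 * (2 * (CD' + d * c * 64))))))) + ((d : ℝ) / 4 * (2 * (2 * d * CRv + 2 * (d : ℝ) ^ 2 * (c ^ 2 * (max (40 * (2 * (1 + CD))) (64 + 40 * (2 * (CD' + d * c * 64)))))) + 2 * (Λ * (CD + CD'))))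 + (CP * EHs * (CD + CD')))) * τ := by
  obtain ⟨h42, h3, h2, h4⟩ := pow_facts hτ0.le hτ1
  have hτ40 : 0 ≤ τ ^ 4 := by positivity
  have hτ41 : τ ^ 4 ≤ 1 := h4.trans hτ1
  have hτ84 : τ ^ 4 * τ ^ 4 ≤ τ ^ 4 := mul_le_of_le_one_right hτ40 hτ41
  have hd0 : (0 : ℝ) ≤ d := Nat.cast_nonneg d
  have hL0 : (0 : ℝ) ≤ L := Nat.cast_nonneg L
  have hi0 : 0 ≤ 1 + τ⁻¹ := add_nonneg zero_le_one (inv_nonneg.mpr hτ0.le)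
  have hX1 : X ≤ CX := hX.trans (mul_le_of_le_one_right hCX0 hτ41)
  have hNX2 : (N * X) ^ 2 ≤ CX ^ 2 * τ ^ 4 := by
    calc (N * X) ^ 2 ≤ (CX * τ ^ 2) ^ 2 := pow_le_pow_left₀ (mul_nonneg hN0.le hX0) hXN 2
      _ = CX ^ 2 * τ ^ 4 := by ring
  have hdna : (d : ℝ) * (N ^ 2 * a) * 64 ≤ d * c * 64 := mul_le_mul_of_nonneg_right (mul_le_mul_of_nonneg_left hna hd0) (by norm_num)
  have hκ : ((2 * (1 + CD)) + (2 * (CD' + d * (N ^ 2 * a) * 64))) ≤ ((2 * (1 + CD)) + (2 * (CD' + d * c * 64))) := by linarith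
  have hκ0 : 0 ≤ ((2 * (1 + CD)) + (2 * (CD' + d * (N ^ 2 * a) * 64))) := by positivity
  have hCPv : (max (40 * (2 * (1 + CD))) (64 + 40 * (2 * (CD' + d * (N ^ 2 * a) * 64)))) ≤ (max (40 * (2 * (1 + CD))) (64 + 40 * (2 * (CD' + d * c * 64)))) := max_le_max le_rfl (by linarith)
  have hCPv0 : 0 ≤ (max (40 * (2 * (1 + CD))) (64 + 40 * (2 * (CD' + d * (N ^ 2 * a) * 64)))) := le_max_of_le_left (by positivity)
  have hCPvs0 : 0 ≤ (max (40 * (2 * (1 + CD))) (64 + 40 * (2 * (CD' + d * c * 64)))) := hCPv0.trans hCPv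
  -- `8d·S₄ ≤ K·τ⁴`
  have hS4 : 8 * d * ((N ^ 2)⁻¹ * CRv
          + (1 + X) ^ 2 * ((d : ℝ) / 4 * L * ((N ^ 2)⁻¹ * CRv)) + X ^ 2 * ((2 * (1 + CD)) + (2 * (CD' + d * (N ^ 2 * a) * 64)))
          + X ^ 2 * (2 * (1 + (d : ℝ) ^ 2) * (L : ℝ) ^ 2 * (N ^ 2 * (max (40 * (2 * (1 + CD))) (64 + 40 * (2 * (CD' + d * (N ^ 2 * a) * 64))))))) ≤ (8 * d * (CRv + (1 + CX) ^ 2 * ((d : ℝ) / 4 * L * CRv) + CX ^ 2 * ((2 * (1 + CD)) + (2 * (CD' + d * c * 64))) + 2 * (1 + (d : ℝ) ^ 2) * (L : ℝ) ^ 2 * (CX ^ 2 * (max (40 * (2 * (1 + CD))) (64 + 40 * (2 * (CD' + d * c * 64))))))) * τ ^ 4 := by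
    have b1 : (N ^ 2)⁻¹ * CRv ≤ τ ^ 4 * CRv := mul_le_mul_of_nonneg_right hNi hCRv
    have b2 : (1 + X) ^ 2 * ((d : ℝ) / 4 * L * ((N ^ 2)⁻¹ * CRv)) ≤ (1 + CX) ^ 2 * ((d : ℝ) / 4 * L * (τ ^ 4 * CRv)) :=
      mul_le_mul (pow_le_pow_left₀ (by positivity) (by linarith) 2) (mul_le_mul_of_nonneg_left b1 (by positivity)) (by positivity) (by positivity)
    have b3 : X ^ 2 * ((2 * (1 + CD)) + (2 * (CD' + d * (N ^ 2 * a) * 64))) ≤ (CX ^ 2 * τ ^ 4) * ((2 * (1 + CD)) + (2 * (CD' + d * c * 64))) := by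
      have hX2 : X ^ 2 ≤ CX ^ 2 * τ ^ 4 := by
        calc X ^ 2 ≤ (CX * τ ^ 4) ^ 2 := pow_le_pow_left₀ hX0 hX 2
          _ = CX ^ 2 * (τ ^ 4 * τ ^ 4) := by ring
          _ ≤ CX ^ 2 * τ ^ 4 := mul_le_mul_of_nonneg_left hτ84 (sq_nonneg _)
      exact mul_le_mul hX2 hκ hκ0 (by positivity)
    have b4 : X ^ 2 * (2 * (1 + (d : ℝ) ^ 2) * (L : ℝ) ^ 2 * (N ^ 2 * (max (40 * (2 * (1 + CD))) (64 + 40 * (2 * (CD' + d * (N ^ 2 * a) * 64))))))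
        ≤ 2 * (1 + (d : ℝ) ^ 2) * (L : ℝ) ^ 2 * ((CX ^ 2 * τ ^ 4) * (max (40 * (2 * (1 + CD))) (64 + 40 * (2 * (CD' + d * c * 64))))) := by
      have e : X ^ 2 * (2 * (1 + (d : ℝ) ^ 2) * (L : ℝ) ^ 2 * (N ^ 2 * (max (40 * (2 * (1 + CD))) (64 + 40 * (2 * (CD' + d * (N ^ 2 * a) * 64))))))
          = 2 * (1 + (d : ℝ) ^ 2) * (L : ℝ) ^ 2 * ((N * X) ^ 2 * (max (40 * (2 * (1 + CD))) (64 + 40 * (2 * (CD' + d * (N ^ 2 * a) * 64))))) := by ring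
      rw [e]
      exact mul_le_mul_of_nonneg_left (mul_le_mul hNX2 hCPv hCPv0 (by positivity)) (by positivity)
    have hsum := add_le_add (add_le_add (add_le_add b1 b2) b3) b4
    calc _ ≤ 8 * d * (τ ^ 4 * CRv + (1 + CX) ^ 2 * ((d : ℝ) / 4 * L * (τ ^ 4 * CRv)) + (CX ^ 2 * τ ^ 4) * ((2 * (1 + CD)) + (2 * (CD' + d * c * 64))) + 2 * (1 + (d : ℝ) ^ 2) * (L : ℝ) ^ 2 * ((CX ^ 2 * τ ^ 4) * (max (40 * (2 * (1 + CD))) (64 + 40 * (2 * (CD' + d * c * 64)))))) :=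
          mul_le_mul_of_nonneg_left hsum (by positivity)
      _ = (8 * d * (CRv + (1 + CX) ^ 2 * ((d : ℝ) / 4 * L * CRv) + CX ^ 2 * ((2 * (1 + CD)) + (2 * (CD' + d * c * 64))) + 2 * (1 + (d : ℝ) ^ 2) * (L : ℝ) ^ 2 * (CX ^ 2 * (max (40 * (2 * (1 + CD))) (64 + 40 * (2 * (CD' + d * c * 64))))))) * τ ^ 4 := by ring
  have haCP : a ^ 2 * (N ^ 2 * (max (40 * (2 * (1 + CD))) (64 + 40 * (2 * (CD' + d * (N ^ 2 * a) * 64))))) ≤ c ^ 2 * τ ^ 4 * (max (40 * (2 * (1 + CD))) (64 + 40 * (2 * (CD' + d * c * 64)))) := by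
    rw [← mul_assoc]; exact mul_le_mul haN hCPv hCPv0 (by positivity)
  have hιC : (N ^ 2)⁻¹ * CRv ≤ τ ^ 4 * CRv := mul_le_mul_of_nonneg_right hNi hCRv
  have h22 : 2 * (d : ℝ) ^ 2 * a ^ 2 * (N ^ 2 * (max (40 * (2 * (1 + CD))) (64 + 40 * (2 * (CD' + d * (N ^ 2 * a) * 64))))) ≤ 2 * (d : ℝ) ^ 2 * (c ^ 2 * τ ^ 4 * (max (40 * (2 * (1 + CD))) (64 + 40 * (2 * (CD' + d * c * 64))))) := by
    rw [mul_assoc (2 * (d : ℝ) ^ 2)]; exact mul_le_mul_of_nonneg_left haCP (by positivity)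
  have h33 : 2 * d * ((N ^ 2)⁻¹ * CRv) ≤ 2 * d * (τ ^ 4 * CRv) := mul_le_mul_of_nonneg_left hιC (by positivity)
  -- `T₄ ≤ K₄·τ⁴`, `T₅ ≤ K₅·τ⁴`, `T₆ ≤ K₆·τ²`
  have hT4 : (d : ℝ) / 2 * (2 * d * ((N ^ 2)⁻¹ * CRv) + 2 * (d : ℝ) ^ 2 * a ^ 2 * (N ^ 2 * (max (40 * (2 * (1 + CD))) (64 + 40 * (2 * (CD' + d * (N ^ 2 * a) * 64)))))) ≤ ((d : ℝ) / 2 * (2 * d * CRv + 2 * (d : ℝ) ^ 2 * (c ^ 2 * (max (40 * (2 * (1 + CD))) (64 + 40 * (2 * (CD' + d * c * 64))))))) * τ ^ 4 := by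
    calc _ ≤ (d : ℝ) / 2 * (2 * d * (τ ^ 4 * CRv) + 2 * (d : ℝ) ^ 2 * (c ^ 2 * τ ^ 4 * (max (40 * (2 * (1 + CD))) (64 + 40 * (2 * (CD' + d * c * 64)))))) := mul_le_mul_of_nonneg_left (add_le_add h33 h22) (by positivity)
      _ = ((d : ℝ) / 2 * (2 * d * CRv + 2 * (d : ℝ) ^ 2 * (c ^ 2 * (max (40 * (2 * (1 + CD))) (64 + 40 * (2 * (CD' + d * c * 64))))))) * τ ^ 4 := by ring
  have hT5 : (d : ℝ) / 4 * (2 * (2 * d * ((N ^ 2)⁻¹ * CRv) + 2 * (d : ℝ) ^ 2 * a ^ 2 * (N ^ 2 * (max (40 * (2 * (1 + CD))) (64 + 40 * (2 * (CD' + d * (N ^ 2 * a) * 64)))))) + 2 * (Λ * (N ^ 2)⁻¹ * (CD + CD'))) ≤ ((d : ℝ) / 4 * (2 * (2 * d * CRv + 2 * (d : ℝ) ^ 2 * (c ^ 2 * (max (40 * (2 * (1 + CD))) (64 + 40 * (2 * (CD' + d * c * 64)))))) + 2 * (Λ * (CD + CD')))) * τ ^ 4 := by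
    have h5 : 2 * (Λ * (N ^ 2)⁻¹ * (CD + CD')) ≤ 2 * (Λ * τ ^ 4 * (CD + CD')) :=
      mul_le_mul_of_nonneg_left (mul_le_mul_of_nonneg_right (mul_le_mul_of_nonneg_left hNi hΛ) (by positivity)) (by norm_num)
    calc _ ≤ (d : ℝ) / 4 * (2 * (2 * d * (τ ^ 4 * CRv) + 2 * (d : ℝ) ^ 2 * (c ^ 2 * τ ^ 4 * (max (40 * (2 * (1 + CD))) (64 + 40 * (2 * (CD' + d * c * 64)))))) + 2 * (Λ * τ ^ 4 * (CD + CD'))) :=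
          mul_le_mul_of_nonneg_left (add_le_add (mul_le_mul_of_nonneg_left (add_le_add h33 h22) (by norm_num)) h5) (by positivity)
      _ = ((d : ℝ) / 4 * (2 * (2 * d * CRv + 2 * (d : ℝ) ^ 2 * (c ^ 2 * (max (40 * (2 * (1 + CD))) (64 + 40 * (2 * (CD' + d * c * 64)))))) + 2 * (Λ * (CD + CD')))) * τ ^ 4 := by ring
  have hT6 : CP * eH * (CD + CD') ≤ (CP * EHs * (CD + CD')) * τ ^ 2 := by
    calc CP * eH * (CD + CD') ≤ CP * (EHs * τ ^ 2) * (CD + CD') := mul_le_mul_of_nonneg_right (mul_le_mul_of_nonneg_left heH hCP) (by positivity)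
      _ = (CP * EHs * (CD + CD')) * τ ^ 2 := by ring
  have hK0 : 0 ≤ (8 * d * (CRv + (1 + CX) ^ 2 * ((d : ℝ) / 4 * L * CRv) + CX ^ 2 * ((2 * (1 + CD)) + (2 * (CD' + d * c * 64))) + 2 * (1 + (d : ℝ) ^ 2) * (L : ℝ) ^ 2 * (CX ^ 2 * (max (40 * (2 * (1 + CD))) (64 + 40 * (2 * (CD' + d * c * 64))))))) + ((d : ℝ) / 2 * (2 * d * CRv + 2 * (d : ℝ) ^ 2 * (c ^ 2 * (max (40 * (2 * (1 + CD))) (64 + 40 * (2 * (CD' + d * c * 64))))))) + ((d : ℝ) / 4 * (2 * (2 * d * CRv + 2 * (d : ℝ) ^ 2 * (c ^ 2 * (max (40 * (2 * (1 + CD))) (64 + 40 * (2 * (CD' + d * c * 64)))))) + 2 * (Λ * (CD + CD')))) := by positivity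
  have hK60 : 0 ≤ (CP * EHs * (CD + CD')) := by positivity
  -- `(1+τ⁻¹)·(8dS₄ + T₄ + T₅ + T₆) ≤ 2(K + K₄ + K₅ + K₆)·τ`
  have hQ : (1 + τ⁻¹) * (8 * d * ((N ^ 2)⁻¹ * CRv
          + (1 + X) ^ 2 * ((d : ℝ) / 4 * L * ((N ^ 2)⁻¹ * CRv)) + X ^ 2 * ((2 * (1 + CD)) + (2 * (CD' + d * (N ^ 2 * a) * 64)))
          + X ^ 2 * (2 * (1 + (d : ℝ) ^ 2) * (L : ℝ) ^ 2 * (N ^ 2 * (max (40 * (2 * (1 + CD))) (64 + 40 * (2 * (CD' + d * (N ^ 2 * a) * 64)))))))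
        + (d : ℝ) / 2 * (2 * d * ((N ^ 2)⁻¹ * CRv) + 2 * (d : ℝ) ^ 2 * a ^ 2 * (N ^ 2 * (max (40 * (2 * (1 + CD))) (64 + 40 * (2 * (CD' + d * (N ^ 2 * a) * 64))))))
        + (d : ℝ) / 4 * (2 * (2 * d * ((N ^ 2)⁻¹ * CRv) + 2 * (d : ℝ) ^ 2 * a ^ 2 * (N ^ 2 * (max (40 * (2 * (1 + CD))) (64 + 40 * (2 * (CD' + d * (N ^ 2 * a) * 64)))))) + 2 * (Λ * (N ^ 2)⁻¹ * (CD + CD')))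
        + CP * eH * (CD + CD')) ≤ 2 * ((8 * d * (CRv + (1 + CX) ^ 2 * ((d : ℝ) / 4 * L * CRv) + CX ^ 2 * ((2 * (1 + CD)) + (2 * (CD' + d * c * 64))) + 2 * (1 + (d : ℝ) ^ 2) * (L : ℝ) ^ 2 * (CX ^ 2 * (max (40 * (2 * (1 + CD))) (64 + 40 * (2 * (CD' + d * c * 64))))))) + ((d : ℝ) / 2 * (2 * d * CRv + 2 * (d : ℝ) ^ 2 * (c ^ 2 * (max (40 * (2 * (1 + CD))) (64 + 40 * (2 * (CD' + d * c * 64))))))) + ((d : ℝ) / 4 * (2 * (2 * d * CRv + 2 * (d : ℝ) ^ 2 * (c ^ 2 * (max (40 * (2 * (1 + CD))) (64 + 40 * (2 * (CD' + d * c * 64)))))) + 2 * (Λ * (CD + CD')))) + (CP * EHs * (CD + CD'))) * τ := by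
    have hA : 8 * d * ((N ^ 2)⁻¹ * CRv
          + (1 + X) ^ 2 * ((d : ℝ) / 4 * L * ((N ^ 2)⁻¹ * CRv)) + X ^ 2 * ((2 * (1 + CD)) + (2 * (CD' + d * (N ^ 2 * a) * 64)))
          + X ^ 2 * (2 * (1 + (d : ℝ) ^ 2) * (L : ℝ) ^ 2 * (N ^ 2 * (max (40 * (2 * (1 + CD))) (64 + 40 * (2 * (CD' + d * (N ^ 2 * a) * 64)))))))
        + (d : ℝ) / 2 * (2 * d * ((N ^ 2)⁻¹ * CRv) + 2 * (d : ℝ) ^ 2 * a ^ 2 * (N ^ 2 * (max (40 * (2 * (1 + CD))) (64 + 40 * (2 * (CD' + d * (N ^ 2 * a) * 64))))))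
        + (d : ℝ) / 4 * (2 * (2 * d * ((N ^ 2)⁻¹ * CRv) + 2 * (d : ℝ) ^ 2 * a ^ 2 * (N ^ 2 * (max (40 * (2 * (1 + CD))) (64 + 40 * (2 * (CD' + d * (N ^ 2 * a) * 64)))))) + 2 * (Λ * (N ^ 2)⁻¹ * (CD + CD'))) ≤ ((8 * d * (CRv + (1 + CX) ^ 2 * ((d : ℝ) / 4 * L * CRv) + CX ^ 2 * ((2 * (1 + CD)) + (2 * (CD' + d * c * 64))) + 2 * (1 + (d : ℝ) ^ 2) * (L : ℝ) ^ 2 * (CX ^ 2 * (max (40 * (2 * (1 + CD))) (64 + 40 * (2 * (CD' + d * c * 64))))))) + ((d : ℝ) / 2 * (2 * d * CRv + 2 * (d : ℝ) ^ 2 * (c ^ 2 * (max (40 * (2 * (1 + CD))) (64 + 40 * (2 * (CD' + d * c * 64))))))) + ((d : ℝ) / 4 * (2 * (2 * d * CRv + 2 * (d : ℝ) ^ 2 * (c ^ 2 * (max (40 * (2 * (1 + CD))) (64 + 40 * (2 * (CD' + d * c * 64)))))) + 2 * (Λ * (CD + CD'))))) * τ ^ 4 :=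
      (add_le_add (add_le_add hS4 hT4) hT5).trans (le_of_eq (by ring))
    have h1 := one_add_inv_mul_pow4_le hτ0 hτ1 hK0
    have h2' := one_add_inv_mul_sq_le hτ0 hτ1 hK60
    calc _ = (1 + τ⁻¹) * (8 * d * ((N ^ 2)⁻¹ * CRv
          + (1 + X) ^ 2 * ((d : ℝ) / 4 * L * ((N ^ 2)⁻¹ * CRv)) + X ^ 2 * ((2 * (1 + CD)) + (2 * (CD' + d * (N ^ 2 * a) * 64)))
          + X ^ 2 * (2 * (1 + (d : ℝ) ^ 2) * (L : ℝ) ^ 2 * (N ^ 2 * (max (40 * (2 * (1 + CD))) (64 + 40 * (2 * (CD' + d * (N ^ 2 * a) * 64)))))))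
        + (d : ℝ) / 2 * (2 * d * ((N ^ 2)⁻¹ * CRv) + 2 * (d : ℝ) ^ 2 * a ^ 2 * (N ^ 2 * (max (40 * (2 * (1 + CD))) (64 + 40 * (2 * (CD' + d * (N ^ 2 * a) * 64))))))
        + (d : ℝ) / 4 * (2 * (2 * d * ((N ^ 2)⁻¹ * CRv) + 2 * (d : ℝ) ^ 2 * a ^ 2 * (N ^ 2 * (max (40 * (2 * (1 + CD))) (64 + 40 * (2 * (CD' + d * (N ^ 2 * a) * 64)))))) + 2 * (Λ * (N ^ 2)⁻¹ * (CD + CD')))) + (1 + τ⁻¹) * (CP * eH * (CD + CD')) := by ring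
      _ ≤ (1 + τ⁻¹) * (((8 * d * (CRv + (1 + CX) ^ 2 * ((d : ℝ) / 4 * L * CRv) + CX ^ 2 * ((2 * (1 + CD)) + (2 * (CD' + d * c * 64))) + 2 * (1 + (d : ℝ) ^ 2) * (L : ℝ) ^ 2 * (CX ^ 2 * (max (40 * (2 * (1 + CD))) (64 + 40 * (2 * (CD' + d * c * 64))))))) + ((d : ℝ) / 2 * (2 * d * CRv + 2 * (d : ℝ) ^ 2 * (c ^ 2 * (max (40 * (2 * (1 + CD))) (64 + 40 * (2 * (CD' + d * c * 64))))))) + ((d : ℝ) / 4 * (2 * (2 * d * CRv + 2 * (d : ℝ) ^ 2 * (c ^ 2 * (max (40 * (2 * (1 + CD))) (64 + 40 * (2 * (CD' + d * c * 64)))))) + 2 * (Λ * (CD + CD'))))) * τ ^ 4) + (1 + τ⁻¹) * ((CP * EHs * (CD + CD')) * τ ^ 2) :=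
          add_le_add (mul_le_mul_of_nonneg_left hA hi0) (mul_le_mul_of_nonneg_left hT6 hi0)
      _ ≤ 2 * ((8 * d * (CRv + (1 + CX) ^ 2 * ((d : ℝ) / 4 * L * CRv) + CX ^ 2 * ((2 * (1 + CD)) + (2 * (CD' + d * c * 64))) + 2 * (1 + (d : ℝ) ^ 2) * (L : ℝ) ^ 2 * (CX ^ 2 * (max (40 * (2 * (1 + CD))) (64 + 40 * (2 * (CD' + d * c * 64))))))) + ((d : ℝ) / 2 * (2 * d * CRv + 2 * (d : ℝ) ^ 2 * (c ^ 2 * (max (40 * (2 * (1 + CD))) (64 + 40 * (2 * (CD' + d * c * 64))))))) + ((d : ℝ) / 4 * (2 * (2 * d * CRv + 2 * (d : ℝ) ^ 2 * (c ^ 2 * (max (40 * (2 * (1 + CD))) (64 + 40 * (2 * (CD' + d * c * 64)))))) + 2 * (Λ * (CD + CD'))))) * τ + 2 * (CP * EHs * (CD + CD')) * τ := add_le_add h1 h2'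
      _ = _ := by ring
  refine ⟨by positivity, ?_⟩
  calc τ + 3 * (1 + τ⁻¹) * (8 * d * ((N ^ 2)⁻¹ * CRv
          + (1 + X) ^ 2 * ((d : ℝ) / 4 * L * ((N ^ 2)⁻¹ * CRv)) + X ^ 2 * ((2 * (1 + CD)) + (2 * (CD' + d * (N ^ 2 * a) * 64)))
          + X ^ 2 * (2 * (1 + (d : ℝ) ^ 2) * (L : ℝ) ^ 2 * (N ^ 2 * (max (40 * (2 * (1 + CD))) (64 + 40 * (2 * (CD' + d * (N ^ 2 * a) * 64)))))))
        + (d : ℝ) / 2 * (2 * d * ((N ^ 2)⁻¹ * CRv) + 2 * (d : ℝ) ^ 2 * a ^ 2 * (N ^ 2 * (max (40 * (2 * (1 + CD))) (64 + 40 * (2 * (CD' + d * (N ^ 2 * a) * 64))))))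
        + (d : ℝ) / 4 * (2 * (2 * d * ((N ^ 2)⁻¹ * CRv) + 2 * (d : ℝ) ^ 2 * a ^ 2 * (N ^ 2 * (max (40 * (2 * (1 + CD))) (64 + 40 * (2 * (CD' + d * (N ^ 2 * a) * 64)))))) + 2 * (Λ * (N ^ 2)⁻¹ * (CD + CD')))
        + CP * eH * (CD + CD'))
      = τ + 3 * ((1 + τ⁻¹) * (8 * d * ((N ^ 2)⁻¹ * CRv
          + (1 + X) ^ 2 * ((d : ℝ) / 4 * L * ((N ^ 2)⁻¹ * CRv)) + X ^ 2 * ((2 * (1 + CD)) + (2 * (CD' + d * (N ^ 2 * a) * 64)))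
          + X ^ 2 * (2 * (1 + (d : ℝ) ^ 2) * (L : ℝ) ^ 2 * (N ^ 2 * (max (40 * (2 * (1 + CD))) (64 + 40 * (2 * (CD' + d * (N ^ 2 * a) * 64)))))))
        + (d : ℝ) / 2 * (2 * d * ((N ^ 2)⁻¹ * CRv) + 2 * (d : ℝ) ^ 2 * a ^ 2 * (N ^ 2 * (max (40 * (2 * (1 + CD))) (64 + 40 * (2 * (CD' + d * (N ^ 2 * a) * 64))))))
        + (d : ℝ) / 4 * (2 * (2 * d * ((N ^ 2)⁻¹ * CRv) + 2 * (d : ℝ) ^ 2 * a ^ 2 * (N ^ 2 * (max (40 * (2 * (1 + CD))) (64 + 40 * (2 * (CD' + d * (N ^ 2 * a) * 64)))))) + 2 * (Λ * (N ^ 2)⁻¹ * (CD + CD')))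
        + CP * eH * (CD + CD'))) := by ring
    _ ≤ τ + 3 * (2 * ((8 * d * (CRv + (1 + CX) ^ 2 * ((d : ℝ) / 4 * L * CRv) + CX ^ 2 * ((2 * (1 + CD)) + (2 * (CD' + d * c * 64))) + 2 * (1 + (d : ℝ) ^ 2) * (L : ℝ) ^ 2 * (CX ^ 2 * (max (40 * (2 * (1 + CD))) (64 + 40 * (2 * (CD' + d * c * 64))))))) + ((d : ℝ) / 2 * (2 * d * CRv + 2 * (d : ℝ) ^ 2 * (c ^ 2 * (max (40 * (2 * (1 + CD))) (64 + 40 * (2 * (CD' + d * c * 64))))))) + ((d : ℝ) / 4 * (2 * (2 * d * CRv + 2 * (d : ℝ) ^ 2 * (c ^ 2 * (max (40 * (2 * (1 + CD))) (64 + 40 * (2 * (CD' + d * c * 64)))))) + 2 * (Λ * (CD + CD')))) + (CP * EHs * (CD + CD'))) * τ) := by linarith [hQ]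
    _ = (1 + 6 * ((8 * d * (CRv + (1 + CX) ^ 2 * ((d : ℝ) / 4 * L * CRv) + CX ^ 2 * ((2 * (1 + CD)) + (2 * (CD' + d * c * 64))) + 2 * (1 + (d : ℝ) ^ 2) * (L : ℝ) ^ 2 * (CX ^ 2 * (max (40 * (2 * (1 + CD))) (64 + 40 * (2 * (CD' + d * c * 64))))))) + ((d : ℝ) / 2 * (2 * d * CRv + 2 * (d : ℝ) ^ 2 * (c ^ 2 * (max (40 * (2 * (1 + CD))) (64 + 40 * (2 * (CD' + d * c * 64))))))) + ((d : ℝ) / 4 * (2 * (2 * d * CRv + 2 * (d : ℝ) ^ 2 * (c ^ 2 * (max (40 * (2 * (1 + CD))) (64 + 40 * (2 * (CD' + d * c * 64)))))) + 2 * (Λ * (CD + CD')))) + (CP * EHs * (CD + CD')))) * τ := by ring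

end Summit.QuantumFields.BalabanUV.T4Continuum.VariationalColourTaxiOneMinDecayCore

end
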